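import Literature.Analysis.FluidPDE.NSUnconditionalUniqueness
import Literature.Analysis.FluidPDE.NSFiniteEnergyUniqueness
import Literature.Analysis.FluidPDE.TaoLocalisation
import Literature.Analysis.FluidPDE.TaoH1Mild

/-!
# Tao's unconditional uniqueness (Cor. 11.4): decomposition along the printed proof

Sibling of `NSUnconditionalUniqueness.lean` (fact `NS.tao_unconditional_uniqueness_velocity`,
Tao2011 Cor. 11.4 in velocity form). The printed proof (Remark 11.3 and the sentence preceding
Cor. 11.4, p. 69 = arXiv p. 36) is the chain

1. **Cor. 11.1** (Bounded enstrophy, p. 68): an almost smooth finite energy solution whose data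
   have finite `H¹` norm lies in `X¹([0, T] × ℝ³)` (is an *`H¹` solution*) — no hypothesis on the
   pressure. Vendored fact: `NS.tao2011_boundedEnstrophy` (`TaoLocalisation.lean`), hinge class
   `NS.MemSobolevX 1 T u`.
2. **Cor. 4.3** (p. 28): an almost smooth `H¹` solution `(u, p)` — arbitrary pressure — gives the
   mild `H¹` solution `(u, p̃)` with the normalised pressure `p̃ = -Δ⁻¹∂ᵢ∂ⱼ(uᵢuⱼ)` (Lemma 4.1 (i):
   `∇p = ∇p̃` for a.e. `t`), same velocity.
3. **Thm. 5.4 (iii)** (p. 33): there is at most one `H¹` mild solution with given `H¹` data.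

Step 1 rests on the enstrophy localisation Thm. 10.1 (with Thm. 8.2, Prop. 9.1, Lemma 8.1);
steps 2–3 on the `H¹` local well-posedness theory of §5 and the pressure decomposition of §4.
The two halves are disjoint theories, so — exactly as for `NS.tao2011_hasBoundedSobolevNormsOn`
(= Cor. 11.1 + Cor. 4.3 + Thm. 5.4 (iv), decomposed in `TaoLocalisation.lean`) — we vendor
steps 2 + 3 as one named fact on classical solutions in `X¹`,
`NS.tao2011_velocity_eq_of_memSobolevX`, and **prove** the assembly

* `NS.tao_unconditional_uniqueness_velocity_of_parts :
    tao2011_boundedEnstrophy → tao2011_velocity_eq_of_memSobolevX →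
    tao_unconditional_uniqueness_velocity`

(glue: an `ℝ≥0∞` energy bound `C < ⊤` is an `ℝ≥0` bound; `∇u₀ ∈ L²` is
`∫ ‖D¹u(0)‖² < ∞` since `‖D¹u₀(x)‖ = ‖∇u₀(x)‖`, Mathlib `norm_iteratedFDeriv_fderiv`), together with
the printed form `NS.tao_unconditional_uniqueness_of_parts` and the equivalence
`NS.tao_unconditional_uniqueness_velocity_iff` with the duplicate vendoring
`NS.tao_finite_energy_velocity_uniqueness` (`NSFiniteEnergyUniqueness.lean`, same statement with
`∫⁻ ‖u₀‖ₑ² < ⊤`, `∫⁻ ‖∇u₀‖ₑ² < ⊤` in place of `MemLp u₀ 2`, `MemLp (∇u₀) 2`; for the smooth slice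
`u₀ = u 0` measurability is automatic, so the two agree). Discharging the two named facts thus
discharges all three vendored forms of Cor. 11.4.

## Second layer: steps 2 and 3 separated (mild hinge)

`TaoH1Mild.lean` vendors step 2 on its own, in the tested (duality) form of the Duhamel formula
carried by the accepted `Fluid.IsMildNSSolutionOn`:
`NS.tao2011_isMildNSSolutionOn_of_memSobolevX` (Cor. 4.3: a classical `X¹` solution on the closed
slab is mild from its datum `u(0)`). We vendor step 3 in the matching shape,

* `NS.tao2011_velocity_eq_of_isMildNSSolutionOn` — **Thm. 5.4 (iii)** (arXiv Thm. 31 (iii),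
  p. 18: *uniqueness of `H¹` mild solutions*), for velocities that are classical on the closed
  slab, lie in `X¹`, and are mild from a common datum,

and **prove** `NS.tao2011_velocity_eq_of_memSobolevX_of_parts : (Cor. 4.3) → (Thm. 5.4 (iii)) →
tao2011_velocity_eq_of_memSobolevX`, whence the three-fact assembly
`NS.tao_unconditional_uniqueness_velocity_of_parts' : (Cor. 11.1) → (Cor. 4.3) → (Thm. 5.4 (iii))
→ tao_unconditional_uniqueness_velocity` — one named fact per numbered result in Remark 11.3's
chain, the Cor. 4.3 node being shared with the decomposition of
`NS.tao2011_hasBoundedSobolevNormsOn` (`TaoH1Mild.lean`). As there (module docstring, *Design*),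
the Thm. 5.4 (iii) fact keeps the hypothesis that the velocities are classical solutions on the
closed slab: the accepted class `NS.MemSobolevX` measures `iteratedFDeriv ℝ n (u t)` and is
meaningful only for smooth slices, and this is the only case the chain uses; it is a subclass of
Tao's `H¹` mild solutions (dictionary in `TaoH1Mild.lean`: for `u ∈ X¹` the tested identity from
the datum and Tao's (13) with the normalised pressure say the same thing), so the fact is weaker
than or equal to print, and it is a formal consequence of `tao2011_velocity_eq_of_memSobolevX`
(`tao2011_velocity_eq_of_isMildNSSolutionOn_of_memSobolevX`), so nothing new is asserted beyond
the first layer.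

## References

* T. Tao, *Localisation and compactness properties of the Navier–Stokes global regularity
  problem*, Anal. PDE 6 (2013) 25–107 = arXiv:1108.1165 (`Tao2011`): Cor. 11.4, Remark 11.3
  (p. 69), Cor. 11.1 (p. 68), Cor. 4.3 (p. 28), Lemma 4.1 (p. 24), Thm. 5.4 (i), (iii) (p. 33),
  (7) (p. 3), (31) (p. 22, viscosity/scaling), footnote 3 (p. 4).
-/

noncomputable section

open MeasureTheory Set Function
open scoped ENNReal NNReal ContDiff

namespace Literature.Analysis.FluidPDE

/-- Local notation for physical space `ℝ³ = EuclideanSpace ℝ (Fin 3)`. -/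
local notation "ℝ³" => EuclideanSpace ℝ (Fin 3)

/-- **Tao 2011, Cor. 4.3 + Thm. 5.4 (iii)** — printed statements. Cor. 4.3 (*Almost smooth `H¹`
solutions are essentially mild*, p. 28): "Let `(u, p, u₀, f, T)` be an almost smooth `H¹`
solution. Then `(u, p̃, u₀, f, T)` is a mild `H¹` solution, where
`p̃ := -Δ⁻¹∂ᵢ∂ⱼ(uᵢuⱼ) + Δ⁻¹∇ · f`. Furthermore, for almost every `t ∈ [0, T]`, `p(t)` and `p̃(t)`
differ by a constant (and thus `∇p = ∇p̃`)." Thm. 5.4 (iii) (*Uniqueness*, p. 33): "Let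
`(u₀, f, T)` be `H¹` data. … There is at most one `H¹` mild solution `(u, p, u₀, f, T)` with the
indicated data" (and (i): an `H¹` mild solution is `C⁰_t H¹_x`). Here an *`H¹` solution* is
((7), p. 3) one with `H¹` data and `‖u‖_{L^∞_t H¹_x([0,T] × ℝ³)} + ‖u‖_{L²_t H²_x([0,T] × ℝ³)} < ∞`,
i.e. `u ∈ X¹([0, T] × ℝ³)`; no hypothesis is placed on the pressure `p` (Cor. 4.3 replaces it by
`p̃` without changing `u`). Consequence vendored, in the homogeneous case `f = 0`, for viscosity
`ν > 0` (Tao writes `ν = 1`; footnote 3 / (31): rescale `v(s, x) = ν⁻¹u(s/ν, x)`,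
`q(s, x) = ν⁻²p(s/ν, x)`, which preserves every class involved) and for classical solutions on
the **closed** slab `[0, T] × ℝ³` (`Fluid.IsClassicalNSSolutionOn (Icc 0 T)`, jointly `C^∞`, a
subclass of Tao's almost smooth solutions, p. 8): if `(u, p)` and `(v, q)` are two such solutions,
both in `X¹([0, T] × ℝ³)` (`MemSobolevX 1 T`, so that with their common datum `u(0) = v(0)` —
then automatically in `H¹` — they are `H¹` solutions in Tao's sense), then `(u, p̃)` and `(v, q̃)`
are `H¹` mild solutions with the same `H¹` data, hence coincide, so `u(t) = v(t)` for every
`t ∈ [0, T]` (equality in `H¹_x` for every `t` by (i), pointwise since the slices are continuous).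
Nothing is asserted about `p`, `q` (they may differ by any smooth `C(t)`, symmetry (32)). [cite: Tao2011, Cor. 4.3 + Thm. 5.4 (iii)] -/
def tao2011_velocity_eq_of_memSobolevX : Prop :=
  ∀ ⦃ν T : ℝ⦄ (_hν : 0 < ν) (_hT : 0 < T) ⦃u v : ℝ → ℝ³ → ℝ³⦄ ⦃p q : ℝ → ℝ³ → ℝ⦄
    (_hu : FluidPDE.IsClassicalNSSolutionOn (Icc 0 T) ν 0 u p)
    (_hv : FluidPDE.IsClassicalNSSolutionOn (Icc 0 T) ν 0 v q)
    (_hXu : MemSobolevX 1 T u) (_hXv : MemSobolevX 1 T v) (_h0 : u 0 = v 0),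
    ∀ t ∈ Icc 0 T, u t = v t

/-- An `ℝ≥0∞` energy bound `C < ⊤` on `[0, T]` is an `ℝ≥0` energy bound (the shape consumed by
`tao2011_boundedEnstrophy`). [folklore] -/
theorem exists_nnreal_energy_bound_of_lt_top {T : ℝ} {w : ℝ → ℝ³ → ℝ³}
    (h : ∃ C : ℝ≥0∞, C < ⊤ ∧ ∀ t ∈ Icc 0 T, ∫⁻ x, ‖w t x‖ₑ ^ 2 ≤ C) :
    ∃ C : ℝ≥0, ∀ t ∈ Icc 0 T, ∫⁻ x, ‖w t x‖ₑ ^ 2 ≤ C := by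
  obtain ⟨C, hC, hb⟩ := h
  exact ⟨C.toNNReal, fun t ht => (hb t ht).trans_eq (ENNReal.coe_toNNReal hC.ne).symm⟩

/-- `‖D¹u₀(x)‖ = ‖∇u₀(x)‖` (the curried first derivative and the Fréchet derivative have the same
operator norm; Mathlib `norm_iteratedFDeriv_one`), in the `ℝ≥0∞`-valued form used under `∫⁻`. [folklore] -/
theorem enorm_iteratedFDeriv_one {E F : Type*} [NormedAddCommGroup E] [NormedSpace ℝ E]
    [NormedAddCommGroup F] [NormedSpace ℝ F] (u₀ : E → F) (x : E) :
    ‖iteratedFDeriv ℝ 1 u₀ x‖ₑ = ‖fderiv ℝ u₀ x‖ₑ := by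
  rw [← ofReal_norm, ← ofReal_norm, norm_iteratedFDeriv_one]

/-- `∇u₀ ∈ L²` (`MemLp (fderiv ℝ u₀) 2`) gives `∫ ‖D¹u₀‖² < ∞`, the `H¹`-datum hypothesis of
`tao2011_boundedEnstrophy`. [folklore] -/
theorem lintegral_enorm_iteratedFDeriv_one_sq_lt_top {u₀ : ℝ³ → ℝ³}
    (h : MemLp (fderiv ℝ u₀) 2 volume) :
    ∫⁻ x, ‖iteratedFDeriv ℝ 1 u₀ x‖ₑ ^ 2 < ⊤ := by
  have hlt := lintegral_rpow_enorm_lt_top_of_eLpNorm_lt_top two_ne_zero ENNReal.ofNat_ne_top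
    h.eLpNorm_lt_top
  simp only [ENNReal.toReal_ofNat, ENNReal.rpow_ofNat] at hlt
  simpa only [enorm_iteratedFDeriv_one] using hlt

/-- **Assembly (proved): Cor. 11.4 (velocity form) from its two printed ingredients.** Given
Cor. 11.1 (`tao2011_boundedEnstrophy`) and Cor. 4.3 + Thm. 5.4 (iii)
(`tao2011_velocity_eq_of_memSobolevX`), two finite-energy classical solutions of the unforced
Navier–Stokes system on the closed slab `[0, T] × ℝ³` with the same `H¹` datum `u₀` have the same
velocity: the datum has finite `H¹` norm (`∇u₀ ∈ L²`), so by Cor. 11.1 both solutions lie in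
`X¹([0, T] × ℝ³)`, and then Cor. 4.3 + Thm. 5.4 (iii) identify their velocities — the chain of
Remark 11.3 (Lemma 8.1 is used inside Cor. 11.1). [cite: Tao2011, Cor. 11.4 (Remark 11.3)] -/
theorem tao_unconditional_uniqueness_velocity_of_parts (hA : tao2011_boundedEnstrophy)
    (hB : tao2011_velocity_eq_of_memSobolevX) : tao_unconditional_uniqueness_velocity := by
  intro ν T hν hT u₀ _h₀ h₁ u v p q hu hv hu0 hv0 hEu hEv
  have hH1 : ∫⁻ x, ‖iteratedFDeriv ℝ 1 u₀ x‖ₑ ^ 2 < ⊤ :=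
    lintegral_enorm_iteratedFDeriv_one_sq_lt_top h₁
  have hXu : MemSobolevX 1 T u :=
    hA hν hT hu (exists_nnreal_energy_bound_of_lt_top hEu) (by rw [hu0]; exact hH1)
  have hXv : MemSobolevX 1 T v :=
    hA hν hT hv (exists_nnreal_energy_bound_of_lt_top hEv) (by rw [hv0]; exact hH1)
  exact hB hν hT hu hv hXu hXv (hu0.trans hv0.symm)

/-- **Assembly (proved): Cor. 11.4 as printed** (both pressures normalised) from the same two
ingredients, via the velocity form (`tao_unconditional_uniqueness.of_velocity`). [cite: Tao2011, Cor. 11.4] -/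
theorem tao_unconditional_uniqueness_of_parts (hA : tao2011_boundedEnstrophy)
    (hB : tao2011_velocity_eq_of_memSobolevX) : tao_unconditional_uniqueness :=
  tao_unconditional_uniqueness.of_velocity (tao_unconditional_uniqueness_velocity_of_parts hA hB)

/-- For the smooth slice `u₀ = u 0` of a classical solution the two renderings of "`H¹` datum"
agree: `MemLp u₀ 2 ∧ MemLp (∇u₀) 2` iff `∫⁻ ‖u₀‖ₑ² < ⊤ ∧ ∫⁻ ‖∇u₀‖ₑ² < ⊤` (a `C^∞` map and its
derivative are continuous, hence measurable). [folklore] -/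
theorem memLp_two_and_iff_of_contDiff {u₀ : ℝ³ → ℝ³} (h : ContDiff ℝ ∞ u₀) :
    (MemLp u₀ 2 volume ∧ MemLp (fderiv ℝ u₀) 2 volume) ↔
      (∫⁻ x, ‖u₀ x‖ₑ ^ 2) < ⊤ ∧ (∫⁻ x, ‖fderiv ℝ u₀ x‖ₑ ^ 2) < ⊤ := by
  have key : ∀ {F : Type} [NormedAddCommGroup F] {g : ℝ³ → F} (_ : Continuous g),
      MemLp g 2 volume ↔ (∫⁻ x, ‖g x‖ₑ ^ 2) < ⊤ := by
    intro F _ g hg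
    have h2 := eLpNorm_lt_top_iff_lintegral_rpow_enorm_lt_top (f := g) (μ := (volume : Measure ℝ³))
      two_ne_zero ENNReal.ofNat_ne_top
    simp only [ENNReal.toReal_ofNat, ENNReal.rpow_ofNat] at h2
    exact ⟨fun hm => h2.1 hm.eLpNorm_lt_top, fun hl => ⟨hg.aestronglyMeasurable, h2.2 hl⟩⟩
  rw [key h.continuous, key (h.continuous_fderiv (by simp))]

/-- The two vendored velocity forms of Cor. 11.4 — `tao_unconditional_uniqueness_velocity`
(`H¹` datum as `MemLp u₀ 2`, `MemLp (∇u₀) 2`) and `tao_finite_energy_velocity_uniqueness`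
(`NSFiniteEnergyUniqueness.lean`; `∫⁻ ‖u₀‖ₑ² < ⊤`, `∫⁻ ‖∇u₀‖ₑ² < ⊤`) — are equivalent, since the
datum `u₀ = u(0)` is a smooth slice of the classical solution (`memLp_two_and_iff_of_contDiff`).
PROVED. [cite: Tao2011, Cor. 11.4] -/
theorem tao_unconditional_uniqueness_velocity_iff :
    tao_unconditional_uniqueness_velocity ↔ tao_finite_energy_velocity_uniqueness := by
  constructor
  · intro h ν T hν hT u₀ h₀ h₁ u v p q hu hv hu0 hv0 hEu hEv
    have hsm : ContDiff ℝ ∞ u₀ := hu0 ▸ hu.contDiff_velocity ⟨le_rfl, hT.le⟩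
    obtain ⟨hm0, hm1⟩ := (memLp_two_and_iff_of_contDiff hsm).2 ⟨h₀, h₁⟩
    exact h ν T hν hT u₀ hm0 hm1 u v p q hu hv hu0 hv0 hEu hEv
  · intro h ν T hν hT u₀ h₀ h₁ u v p q hu hv hu0 hv0 hEu hEv
    have hsm : ContDiff ℝ ∞ u₀ := hu0 ▸ hu.contDiff_velocity ⟨le_rfl, hT.le⟩
    obtain ⟨hl0, hl1⟩ := (memLp_two_and_iff_of_contDiff hsm).1 ⟨h₀, h₁⟩
    exact h ν T hν hT u₀ hl0 hl1 u v p q hu hv hu0 hv0 hEu hEv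

/-! ### Second layer: Thm. 5.4 (iii) over the mild hinge of `TaoH1Mild.lean` -/

/-- **Tao 2011, Thm. 5.4 (iii) (Uniqueness of `H¹` mild solutions)** (arXiv Thm. 31 (iii),
p. 18). Printed: "Let `(u₀, f, T)` be `H¹` data. … (iii) (Uniqueness) There is at most one `H¹`
mild solution `(u, p, u₀, f, T)` with the indicated data." Here (arXiv p. 6) an *`H¹` mild
solution* consists of `u₀ ∈ H¹_x(ℝ³)`, `u ∈ X¹([0,T] × ℝ³) = L^∞_t H¹_x ∩ L²_t H²_x`, the
normalised pressure `p = -Δ⁻¹∂ᵢ∂ⱼ(uᵢuⱼ) + Δ⁻¹∇·f` and the Duhamel formula (13) from `u₀`.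
Vendored for `f = 0`, `ν > 0` (Tao writes `ν = 1`; footnote-3 rescaling
`v(s, x) = ν⁻¹u(s/ν, x)`, which preserves every class involved) and — exactly as for Thm. 5.4 (iv)
in `NS.tao2011_hasBoundedSobolevNormsOn_of_isMildNSSolutionOn` (`TaoH1Mild.lean`, *Design*: the
accepted `NS.MemSobolevX` measures classical derivatives of the slices, junk elsewhere) — for
velocities that are classical solutions (with some pressures `p`, `q`, on which nothing is
assumed or asserted) on the **closed** slab `[0, T] × ℝ³`: if two such velocities `u`, `v` lie in
`X¹([0,T] × ℝ³)` (`MemSobolevX 1 T`), satisfy the Duhamel formula from their data `u(0)`, `v(0)`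
in the tested form against smooth compactly supported divergence-free fields
(`Fluid.IsMildNSSolutionOn (Icc 0 T) ν 0 (u 0) u`, resp. `(v 0) v`; for `u ∈ X¹` this makes
`(u, p̃, u(0), 0, T)` an `H¹` mild solution in Tao's sense, `p̃` the normalised pressure — see the
dictionary in `TaoH1Mild.lean`; every pairing is an honest integral since `u(t) ∈ L²_x` uniformly
and the tests are Schwartz), and have the same datum `u(0) = v(0)` (then in `H¹_x`), then the two
`H¹` mild solutions `(u, p̃, u(0), 0, T)`, `(v, q̃, u(0), 0, T)` coincide, i.e. `u(t) = v(t)` for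
every `t ∈ [0, T]` (equality in `H¹_x` by (i), pointwise as the slices are continuous). A formal
consequence of `tao2011_velocity_eq_of_memSobolevX` (below), hence weaker than or equal to what the
first layer asserts. [cite: Tao2011, Thm. 5.4 (iii)] -/
def tao2011_velocity_eq_of_isMildNSSolutionOn : Prop :=
  ∀ ⦃ν T : ℝ⦄ (_hν : 0 < ν) (_hT : 0 < T) ⦃u v : ℝ → ℝ³ → ℝ³⦄ ⦃p q : ℝ → ℝ³ → ℝ⦄
    (_hu : FluidPDE.IsClassicalNSSolutionOn (Icc 0 T) ν 0 u p)
    (_hv : FluidPDE.IsClassicalNSSolutionOn (Icc 0 T) ν 0 v q)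
    (_hXu : MemSobolevX 1 T u) (_hXv : MemSobolevX 1 T v)
    (_hmu : FluidPDE.IsMildNSSolutionOn (Icc 0 T) ν 0 (u 0) u)
    (_hmv : FluidPDE.IsMildNSSolutionOn (Icc 0 T) ν 0 (v 0) v) (_h0 : u 0 = v 0),
    ∀ t ∈ Icc 0 T, u t = v t

/-- The Thm. 5.4 (iii) fact is the first-layer composite with the Duhamel formula supplied as a
hypothesis; in particular it asserts nothing beyond `tao2011_velocity_eq_of_memSobolevX`.
PROVED (drop the mild hypotheses). [cite: Tao2011, Cor. 4.3 + Thm. 5.4 (iii)] -/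
theorem tao2011_velocity_eq_of_isMildNSSolutionOn_of_memSobolevX
    (hB : tao2011_velocity_eq_of_memSobolevX) : tao2011_velocity_eq_of_isMildNSSolutionOn :=
  fun _ν _T hν hT _u _v _p _q hu hv hXu hXv _ _ h0 => hB hν hT hu hv hXu hXv h0

/-- **Assembly (proved): Cor. 4.3 + Thm. 5.4 (iii) ⇒ `tao2011_velocity_eq_of_memSobolevX`.**
Two classical `X¹` solutions on the closed slab are mild from their data (Cor. 4.3,
`tao2011_isMildNSSolutionOn_of_memSobolevX`, `TaoH1Mild.lean`), and mild `H¹` solutions with the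
same datum coincide (Thm. 5.4 (iii), `tao2011_velocity_eq_of_isMildNSSolutionOn`). [cite: Tao2011, Cor. 4.3 + Thm. 5.4 (iii)] -/
theorem tao2011_velocity_eq_of_memSobolevX_of_parts
    (hB₁ : tao2011_isMildNSSolutionOn_of_memSobolevX)
    (hB₃ : tao2011_velocity_eq_of_isMildNSSolutionOn) : tao2011_velocity_eq_of_memSobolevX :=
  fun _ν _T hν hT _u _v _p _q hu hv hXu hXv h0 =>
    hB₃ hν hT hu hv hXu hXv (hB₁ hν hT hu hXu) (hB₁ hν hT hv hXv) h0

/-- Given Cor. 4.3, the first-layer composite and the Thm. 5.4 (iii) fact are equivalent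
(so the split loses nothing). PROVED. [cite: Tao2011, Cor. 4.3 + Thm. 5.4 (iii)] -/
theorem tao2011_velocity_eq_of_memSobolevX_iff_of_isMild
    (hB₁ : tao2011_isMildNSSolutionOn_of_memSobolevX) :
    tao2011_velocity_eq_of_memSobolevX ↔ tao2011_velocity_eq_of_isMildNSSolutionOn :=
  ⟨tao2011_velocity_eq_of_isMildNSSolutionOn_of_memSobolevX,
    tao2011_velocity_eq_of_memSobolevX_of_parts hB₁⟩

/-- **Assembly (proved): Cor. 11.4 (velocity form) from the three numbered results of
Remark 11.3's chain** — Cor. 11.1 (bounded enstrophy, `tao2011_boundedEnstrophy`), Cor. 4.3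
(`tao2011_isMildNSSolutionOn_of_memSobolevX`) and Thm. 5.4 (iii)
(`tao2011_velocity_eq_of_isMildNSSolutionOn`); Lemma 8.1 is used inside Cor. 11.1. [cite: Tao2011, Cor. 11.4 (Remark 11.3)] -/
theorem tao_unconditional_uniqueness_velocity_of_parts' (hA : tao2011_boundedEnstrophy)
    (hB₁ : tao2011_isMildNSSolutionOn_of_memSobolevX)
    (hB₃ : tao2011_velocity_eq_of_isMildNSSolutionOn) : tao_unconditional_uniqueness_velocity :=
  tao_unconditional_uniqueness_velocity_of_parts hA
    (tao2011_velocity_eq_of_memSobolevX_of_parts hB₁ hB₃)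

/-- The same three facts give Cor. 11.4 as printed (normalised pressures) and the duplicate
vendoring `tao_finite_energy_velocity_uniqueness`. PROVED. [cite: Tao2011, Cor. 11.4] -/
theorem tao_unconditional_uniqueness_of_parts' (hA : tao2011_boundedEnstrophy)
    (hB₁ : tao2011_isMildNSSolutionOn_of_memSobolevX)
    (hB₃ : tao2011_velocity_eq_of_isMildNSSolutionOn) :
    tao_unconditional_uniqueness ∧ tao_finite_energy_velocity_uniqueness :=
  ⟨tao_unconditional_uniqueness.of_velocity (tao_unconditional_uniqueness_velocity_of_parts' hA hB₁ hB₃),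
    tao_unconditional_uniqueness_velocity_iff.1
      (tao_unconditional_uniqueness_velocity_of_parts' hA hB₁ hB₃)⟩

end Literature.Analysis.FluidPDE

end
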